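import Summits.BirchSwinnertonDyer.BirchSwinnertonDyer.Theorems.PublishedInputsGreenbergCasselsTorsionDescent
import HarnessLib

set_option linter.dupNamespace false -- `…BirchSwinnertonDyer.BirchSwinnertonDyer…` is the cell's nested layout (D-0017)
set_option autoImplicit false

/-!
# Cassels' theorem with rational `p`-torsion, Poitou–Tate input: exactness modulo the Kummer conditions for test classes
# TRIVIAL AT ONE FINITE PLACE `v₀`, lift controlled off `v₀` (Greenberg LNM 1716 §4 Appendix, Prop. 4.13 / remark p. 123)

Seat `bsd-inputs-k4-p1` (gen 7; LADDER-BSD D-0154 KEY (147)(f) «prove the printed input», row 1 K4 INPUTS; Greenberg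
1999), `--supports stmt-BirchSwinnertonDyer-20309`. THEOREMS ONLY (no definition, no named fact, no `sorry`). Part 2a of the
«Cassels with torsion» series (2b = `PublishedInputsGreenbergCasselsEraseOne`, the theorem; 1 = `…CasselsTorsionDescent`).

Greenberg, LNM 1716, remark after Prop. 4.13 (p. 123): "the map `γ' : H¹(F_Σ/F, M) → ∏_{v ∈ Σ, v ≠ v₀} H¹(F_v, M)/L_v` is
surjective … one can study `coker(γ')` by changing `L_{v₀}` to `L'_{v₀} = H¹(F_{v₀}, M)` … `U'^*_{v₀} = 0`". In the tree's
currency: the variant of `SignedEC.CasselsPT.exists_mem_kummerOutside_localization_sub_mem` (K4 w3 g6, Howard Thm. 2.1.11 (i)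
for `𝓕 = (𝓛_v)_v ≤ 𝓖 = kummerRelaxed S'`) in which `𝓕` is ENLARGED to `⊤` at `v₀` (so `𝓕^*_{v₀} = ⊤^* = 0` by local Tate
duality): the test classes acquire the extra property `loc_{v₀} c = 0`, and the lift is controlled modulo `𝓛_v` on
`S' ∖ {v₀}` only:

* `exists_mem_kummerOutside_localization_sub_mem_eraseOne` — for a Poitou–Tate family at level `p^k` (`IsPerfect`,
  `SelmerComplement`), `v₀` finite with `Sum.inr v₀ ∈ S'`: IF `∑_{v∈S'} inv_v(t_v ∪ₑ loc_v c) = 0` for every `c ∈ H¹(K, E[p^k])`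
  Kummer at the finite places, Kummer at the infinite `w` with `inv_w` injective, and with `loc_{v₀} c = 0`, THEN
  `loc_v x − t_v ∈ 𝓛_v` on `S' ∖ {v₀}` for some `x ∈ kummerOutside W (p^k) S'`.

HONEST FRAMING: a re-run of a tree theorem with one local condition changed; CONDITIONAL on the displayed properties of the
family (supplied by `poitouTate_selmerStructure_duality K`, a tree theorem); closes no item; BSD is not proved by any of this.

References: [GreenbergLNM1716] §4 Appendix, Prop. 4.13 and pp. 121–123; [Howard2004HeegnerKolyvagin] Thm. 2.1.11;
[MilneADT2006] I Thm. 4.10(b), Lemma 6.15.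
-/

noncomputable section

open scoped Classical

namespace Summit.BirchSwinnertonDyer.BirchSwinnertonDyer.Theorems.InputsGreenbergCasselsTorsion

open CategoryTheory Field NumberField IsDedekindDomain Function WeierstrassCurve
open Literature.NumberTheory.EllipticCurves Literature.NumberTheory.EllipticCurves.GreenbergSelmer
open Literature.NumberTheory.GaloisRepresentations
open Literature.NumberTheory.GaloisRepresentations.DiscreteGaloisModule (SelmerStructure TateDual
  tateDual localTatePairingZMod unramifiedSubgroup mu MuCarrier)
open Literature.NumberTheory.GaloisCohomology
open Summit.BirchSwinnertonDyer.Rank1Residual.X11b Summit.BirchSwinnertonDyer.Rank1Residual.X11b.KummerPT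
open Summit.BirchSwinnertonDyer.Rank1Residual.X11b.LocBridge
open Summit.BirchSwinnertonDyer.Rank1Residual.X11b.Levels
open Summit.BirchSwinnertonDyer.Rank1Residual.X11b.AcSelmer
open Summit.BirchSwinnertonDyer.Rank1Residual.X11b.FiniteDuality
open Summit.BirchSwinnertonDyer.Rank1Residual.X11b.Relaxation
open Summit.BirchSwinnertonDyer.BirchSwinnertonDyer.Theorems.SignedEC.CasselsPT
open scoped ContRepresentation

/-! ## §1 Poitou–Tate exactness modulo the Kummer conditions, test classes trivial at `v₀`, lift off `v₀` -/

section Exactness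

variable {K : Type} [Field K] [NumberField K] (W : WeierstrassCurve K) [W.IsElliptic] (p k : ℕ)
  [Fact p.Prime]
variable (e : W.geomTorsion ((p ^ k : ℕ) : ℤ) → W.geomTorsion ((p ^ k : ℕ) : ℤ) → AlgebraicClosure K)
  (hμ : ∀ S T, e S T ^ (p ^ k) = 1)
  (hadd₁ : ∀ S₁ S₂ T, e (S₁ + S₂) T = e S₁ T * e S₂ T)
  (hadd₂ : ∀ S T₁ T₂, e S (T₁ + T₂) = e S T₁ * e S T₂)
  (hgal : ∀ (σ : absoluteGaloisGroup K) (S T : W.geomTorsion ((p ^ k : ℕ) : ℤ)),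
    σ • e S T = e (σ • S) (σ • T))
  (halt : ∀ T, e T T = 1) (hnondeg : ∀ T, (∀ S, e S T = 1) → T = 0)

include halt hnondeg in
/-- **Poitou–Tate exactness modulo the Kummer conditions, AWAY FROM `v₀`** (variant of the tree's
`SignedEC.CasselsPT.exists_mem_kummerOutside_localization_sub_mem`). Let `inv` be a Poitou–Tate family at level `p^k`
(`IsPerfect`, `SelmerComplement`), `S'` a finite set of places, `v₀` a finite place with `Sum.inr v₀ ∈ S'`, and
`t_v ∈ H¹(K_v, E[p^k])` local classes. Suppose `∑_{v∈S'} inv_v(t_v ∪ₑ loc_v c) = 0` for every `c ∈ H¹(K, E[p^k])` which is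
Kummer at every finite place, Kummer at every infinite `w` with `inv_w` injective, AND has `loc_{v₀} c = 0`. Then there is
`x ∈ kummerOutside W (p^k) S'` with `loc_v x − t_v ∈ 𝓛_v` for every `v ∈ S'`, `v ≠ Sum.inr v₀`. Proof: Howard 2.1.11 (i)
for `𝓕 =` the Kummer structure with `𝓕_{v₀} := ⊤` (still `≤ 𝓖 = kummerRelaxed S'` as `v₀ ∈ S'`, still unramified off
the exceptional set `T ∋ v₀`); a dual Selmer class `y` for `𝓕^*` is one for the Kummer dual structure (antitonicity), whence
Kummer Weil transport as in the tree, and `loc_{v₀} y ∈ ⊤^* = 0` by local Tate duality at `v₀` (`IsPerfect`).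
[cite: GreenbergLNM1716, §4 Appendix, Prop. 4.13 and p. 123] [cite: Howard2004HeegnerKolyvagin, Thm. 2.1.11 (arXiv:1202.6340 p. 6)]
[cite: MilneADT2006, Ch. I, Thm. 4.10(b)] -/
theorem exists_mem_kummerOutside_localization_sub_mem_eraseOne (hk : 0 < k)
    {inv : LocalInvariants K (p ^ k)} (hperf : inv.IsPerfect) (hcompl : inv.SelmerComplement)
    (S' : Finset (Place K)) (v₀ : HeightOneSpectrum (𝓞 K)) (hv₀ : (Sum.inr v₀ : Place K) ∈ S')
    (t : Π v : Place K, galoisCohomology ((W.torsionGaloisModule ((p ^ k : ℕ) : ℤ)).toLocal v) 1)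
    (ht : ∀ c : galoisCohomology (W.torsionGaloisModule ((p ^ k : ℕ) : ℤ)) 1,
      (∀ v : HeightOneSpectrum (𝓞 K),
        galoisCohomology.localization (W.torsionGaloisModule ((p ^ k : ℕ) : ℤ)) (Sum.inr v) 1 c ∈
          W.kummerSelmerStructure ((p ^ k : ℕ) : ℤ) (Sum.inr v)) →
      (∀ w : InfinitePlace K, Injective (inv (Sum.inl w)) →
        galoisCohomology.localization (W.torsionGaloisModule ((p ^ k : ℕ) : ℤ)) (Sum.inl w) 1 c ∈
          W.kummerSelmerStructure ((p ^ k : ℕ) : ℤ) (Sum.inl w)) →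
      galoisCohomology.localization (W.torsionGaloisModule ((p ^ k : ℕ) : ℤ)) (Sum.inr v₀) 1 c = 0 →
      ∑ v ∈ S', invWeilPairing W (p ^ k) e hμ hadd₁ hadd₂ hgal inv v (t v)
        (galoisCohomology.localization (W.torsionGaloisModule ((p ^ k : ℕ) : ℤ)) v 1 c) = 0) :
    ∃ x ∈ kummerOutside W (p ^ k) S', ∀ v ∈ S', v ≠ Sum.inr v₀ →
      galoisCohomology.localization (W.torsionGaloisModule ((p ^ k : ℕ) : ℤ)) v 1 x - t v ∈
        W.kummerSelmerStructure ((p ^ k : ℕ) : ℤ) v := by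
  classical
  have hprime : p.Prime := Fact.out
  haveI : NeZero (p ^ k) := ⟨pow_ne_zero k hprime.ne_zero⟩
  haveI : Finite (W.geomTorsion ((p ^ k : ℕ) : ℤ)) := finite_geomTorsion_of_neZero W _
  haveI : CompactSpace (absoluteGaloisGroup K) := absoluteGaloisGroup_compactSpace K
  have hpp : IsPrimePow (p ^ k) := ⟨p, k, hprime.prime, hk, rfl⟩
  have hEuler : ∀ v : HeightOneSpectrum (𝓞 K),
      Nat.card (galoisCohomology ((W.torsionGaloisModule ((p ^ k : ℕ) : ℤ)).toLocal (Sum.inr v)) 1) =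
        (Nat.card (nsmulAddMonoidHom (p ^ k) :
            (W.baseChange (v.adicCompletion K)).toAffine.Point →+ _).ker *
          Nat.card (v.adicCompletionIntegers K ⧸
            Ideal.span {((p ^ k : ℕ) : v.adicCompletionIntegers K)})) ^ 2 := fun v ↦
    natCard_galoisCohomology_one_torsion_adicCompletion_eq_sqEP W v (p ^ k) hpp
  obtain ⟨T, hS'T, hinf, hp, hbad⟩ := exists_exceptional_finset W p S'
  have hMn : ∀ m : W.geomTorsion ((p ^ k : ℕ) : ℤ), (p ^ k) • m = 0 := fun m ↦
    AddSubgroup.torsionBy.nsmul m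
  have hTout : ∀ v : HeightOneSpectrum (𝓞 K), (Sum.inr v : Place K) ∉ T →
      ((p ^ k : ℕ) : 𝓞 K) ∉ v.asIdeal ∧
        GaloisRep.IsUnramifiedAt v (W.torsionGaloisModule ((p ^ k : ℕ) : ℤ)) := by
    intro v hv
    have hpv : ((p : ℕ) : 𝓞 K) ∉ v.asIdeal := fun h ↦ hv (hp v h)
    have hgood : W.HasGoodReductionAt v := by
      by_contra hbad'
      exact hv (hbad v hbad')
    exact ⟨natCast_pow_not_mem p hpv _,
      isUnramifiedAt_torsionGaloisModule W hgood (intCast_pow_not_mem p hpv _)⟩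
  -- the structure `𝓕₀`: Kummer everywhere except `⊤` at `v₀`
  let F₀ : SelmerStructure (W.torsionGaloisModule ((p ^ k : ℕ) : ℤ)) :=
    fun v ↦ if v = Sum.inr v₀ then ⊤ else kummerStrict W (p ^ k) (∅ : Finset (Place K)) v
  have hF₀v₀ : F₀ (Sum.inr v₀) = ⊤ := if_pos rfl
  have hF₀ne : ∀ v, v ≠ Sum.inr v₀ → F₀ v = W.kummerSelmerStructure ((p ^ k : ℕ) : ℤ) v := fun v hv ↦ by
    change (if v = Sum.inr v₀ then ⊤ else kummerStrict W (p ^ k) (∅ : Finset (Place K)) v) = _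
    rw [if_neg hv, kummerStrict_empty_apply]
  have hF₀ge : kummerStrict W (p ^ k) (∅ : Finset (Place K)) ≤ F₀ := fun v ↦ by
    by_cases hv : v = Sum.inr v₀
    · subst hv; rw [hF₀v₀]; exact le_top
    · rw [hF₀ne v hv, kummerStrict_empty_apply]
  have hF₀le : F₀ ≤ kummerRelaxed W (p ^ k) S' := fun v ↦ by
    by_cases hv : v = Sum.inr v₀
    · subst hv; rw [kummerRelaxed_of_mem W (p ^ k) S' hv₀]; exact le_top
    · rw [hF₀ne v hv, ← kummerStrict_empty_apply W (p ^ k) v]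
      exact kummerStrict_empty_le_kummerRelaxed W (p ^ k) S' v
  have hF₀unr : F₀.IsUnramifiedOutside T := by
    have hstr := kummerStrict_isUnramifiedOutside W p k ∅ T (Finset.empty_subset T) hinf hp hbad
    refine ⟨hstr.1, fun v hv ↦ ?_⟩
    have hne : (Sum.inr v : Place K) ≠ Sum.inr v₀ := fun h ↦ hv (h ▸ hS'T hv₀)
    rw [hF₀ne _ hne, ← kummerStrict_empty_apply W (p ^ k) (Sum.inr v)]
    exact hstr.2 v hv
  -- the test family, extended by zero off `S'`
  set t' : Π v : Place K, galoisCohomology ((W.torsionGaloisModule ((p ^ k : ℕ) : ℤ)).toLocal v) 1 :=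
    fun v ↦ if v ∈ S' then t v else 0 with ht'def
  have ht'mem : ∀ v ∈ S', t' v = t v := fun v hv ↦ by rw [ht'def]; exact if_pos hv
  have ht'not : ∀ v ∉ S', t' v = 0 := fun v hv ↦ by rw [ht'def]; exact if_neg hv
  have ht' : ∀ v ∈ T, t' v ∈ kummerRelaxed W (p ^ k) S' v := by
    intro v _
    by_cases hv : v ∈ S'
    · rw [kummerRelaxed_of_mem W (p ^ k) S' hv]; exact AddSubgroup.mem_top _
    · rw [ht'not v hv]; exact zero_mem _
  -- Poitou–Tate (Howard 2.1.11 (i)) for `F₀ ≤ kummerRelaxed S'`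
  obtain ⟨x, hx, hxt⟩ := (hcompl (W.torsionGaloisModule ((p ^ k : ℕ) : ℤ)) hMn T hTout
    F₀ (kummerRelaxed W (p ^ k) S') hF₀le hF₀unr
    (kummerRelaxed_isUnramifiedOutside W p k S' T hS'T hinf hp hbad)).1 t' ht' (fun y hy ↦ by
      -- `y` is a dual Selmer class for the Kummer structure, trivial at `v₀`
      have hy' : y ∈ (inv.dualSelmerStructure (W.torsionGaloisModule ((p ^ k : ℕ) : ℤ))
          (kummerStrict W (p ^ k) (∅ : Finset (Place K)))).selmerGroup :=
        inv.selmerGroup_dualSelmerStructure_anti _ hF₀ge hy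
      have hy₀ : galoisCohomology.localization ((W.torsionGaloisModule ((p ^ k : ℕ) : ℤ)).tateDual (p ^ k))
          (Sum.inr v₀) 1 y = 0 := by
        have h := (SelmerStructure.mem_selmerGroup_iff _ y).mp hy (Sum.inr v₀)
        rw [LocalInvariants.dualSelmerStructure_apply, hF₀v₀, LocalInvariants.mem_dualLocalCondition_iff] at h
        have hflip := ((hperf v₀).2 (W.torsionGaloisModule ((p ^ k : ℕ) : ℤ)) hMn).2.1
        apply hflip
        rw [map_zero]
        ext a
        rw [AddMonoidHom.flip_apply, AddMonoidHom.zero_apply]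
        exact h a (AddSubgroup.mem_top a)
      -- the obstruction vanishes
      set yW := galoisCohomology.map (weilDualInv W (p ^ k) e hμ hadd₁ hadd₂ hgal hnondeg) 1 y
        with hyWdef
      have hyW : galoisCohomology.map (weilDualIntertwining W (p ^ k) e hμ hadd₁ hadd₂ hgal) 1 yW = y :=
        map_weilDual_map_weilDualInv W (p ^ k) e hμ hadd₁ hadd₂ hgal hnondeg y
      have hySel := map_weilDualInv_mem_kummer_of_mem_dualSelmerGroup_kummer W (p ^ k) e hμ hadd₁ hadd₂ hgal
        halt hnondeg inv (fun v ↦ (hperf v).1.1) hEuler hy'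
      have hyW₀ : galoisCohomology.localization (W.torsionGaloisModule ((p ^ k : ℕ) : ℤ)) (Sum.inr v₀) 1 yW = 0 := by
        rw [hyWdef, localization_map_one, hy₀]
        exact map_zero _
      have hterm : ∀ v : Place K,
          localTatePairingZMod (W.torsionGaloisModule ((p ^ k : ℕ) : ℤ)) (p ^ k) v (inv v) (t' v)
            (galoisCohomology.localization
              ((W.torsionGaloisModule ((p ^ k : ℕ) : ℤ)).tateDual (p ^ k)) v 1 y) =
          invWeilPairing W (p ^ k) e hμ hadd₁ hadd₂ hgal inv v (t' v)
            (galoisCohomology.localization (W.torsionGaloisModule ((p ^ k : ℕ) : ℤ)) v 1 yW) := by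
        intro v
        rw [← hyW, localization_map_one, localTatePairingZMod_map_weilDual, invWeilPairing_apply]
      calc ∑ v ∈ T, localTatePairingZMod (W.torsionGaloisModule ((p ^ k : ℕ) : ℤ)) (p ^ k) v (inv v)
              (t' v) (galoisCohomology.localization
                ((W.torsionGaloisModule ((p ^ k : ℕ) : ℤ)).tateDual (p ^ k)) v 1 y)
          = ∑ v ∈ T, invWeilPairing W (p ^ k) e hμ hadd₁ hadd₂ hgal inv v (t' v)
              (galoisCohomology.localization (W.torsionGaloisModule ((p ^ k : ℕ) : ℤ)) v 1 yW) :=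
            Finset.sum_congr rfl fun v _ ↦ hterm v
        _ = ∑ v ∈ S', invWeilPairing W (p ^ k) e hμ hadd₁ hadd₂ hgal inv v (t' v)
              (galoisCohomology.localization (W.torsionGaloisModule ((p ^ k : ℕ) : ℤ)) v 1 yW) := by
            refine (Finset.sum_subset hS'T fun v _ hvS' ↦ ?_).symm
            rw [ht'not v hvS', map_zero, AddMonoidHom.zero_apply]
        _ = ∑ v ∈ S', invWeilPairing W (p ^ k) e hμ hadd₁ hadd₂ hgal inv v (t v)
              (galoisCohomology.localization (W.torsionGaloisModule ((p ^ k : ℕ) : ℤ)) v 1 yW) :=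
            Finset.sum_congr rfl fun v hv ↦ by rw [ht'mem v hv]
        _ = 0 := ht yW hySel.1 hySel.2 hyW₀)
  refine ⟨x, ?_, fun v hv hne ↦ ?_⟩
  · rw [← selmerGroup_kummerRelaxed W (p ^ k) S']
    exact hx
  · have h := hxt v (hS'T hv)
    rw [hF₀ne v hne, ht'mem v hv] at h
    exact h

end Exactness

end Summit.BirchSwinnertonDyer.BirchSwinnertonDyer.Theorems.InputsGreenbergCasselsTorsion

end
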